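import Literature.AlgebraicGeometry.Milne1999.SpecialLefschetzGroupInvariantsCM
import Literature.AlgebraicGeometry.Milne1999.LefschetzCentraliserIsogeny
import Literature.AlgebraicGeometry.Milne1999.CMSimpleIsogenousCMTyped
import Literature.AlgebraicGeometry.ComplexMultiplication.CMTypeOfSimpleSubvariety
import Literature.AlgebraicGeometry.Motives.AbelianVarietySimpleOfIsogeny
import Literature.AlgebraicGeometry.HodgeTheory.HodgeClassesIsogenyInvariance
import HarnessLib

/-!
# Milne 1999, Theorem 3.2 / Cor. 4.5 for every SIMPLE complex abelian variety of CM type: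
# the `S(A)`-invariants of `H^{2p}(A(ℂ); ℂ)` are divisor classes

Family `hodge`, layer `Literature/AlgebraicGeometry/Milne1999`, namespace
`Literature.AlgebraicGeometry.Milne1999` (D-0022). THEOREMS ONLY (no definition, no named fact; D-0026).
Sequel of `Milne1999/SpecialLefschetzGroupInvariantsCM` (the torus argument of Milne 1999, p. 657 /
Lemma 3.8, run on a REALISATION `(A, ι, θ)` of a CM type with `θ(K) ⊆ C(A)`). This file removes the
auxiliary data: for every simple complex abelian variety `A` of CM type (`Milne1999.IsOfCMType`, the
binder of `HC_CM`; `0 < dim A`) the conclusion of the cited record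
`Milne1999_specialLefschetzGroup_invariants_le` (Cor. 4.5) holds — the classes of `H^{2p}(A(ℂ); ℂ)` fixed
by `specialLefschetzGroup (dim A) A.X` lie in `Dᵖ_hom(A)_ℂ`. The passage is Milne's "Clearly `S(A)`
depends only on the isogeny class of `A`" (§1 p. 644; the tree's `Milne1999/LefschetzCentraliserIsogeny`)
applied to the isogeny `A → A′` onto an abelian variety carrying a CM-type realisation
(`exists_isCMTyped_isIsogenous_of_isSimple`, Deligne LNM 900 I Prop. 5.1 via Shimura's isogeny theorem),
whose endomorphism ring is commutative because `A′` is again simple of CM type (Milne 1999b §2 p. 54: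
"`End⁰(A)` is a field (necessarily CM) of degree `2 dim A`"; the tree's
`ComplexMultiplication.endAlgebra_comm_and_finrank_eq_of_isSimple_of_isOfCMType`).

## Source, verbatim

J. S. Milne, *Lefschetz classes on abelian varieties*, Duke Math. J. 96 (1999) 639–675
[`paper:doi-10-1215-s0012-7094-99-09620-5`]: Thm. 3.2 (p. 653) "For any abelian variety `A` over `Ω`
and integer `r ≥ 0`, the `k`-algebra `H*(A^r)^{S(A)}` is generated by divisor classes."; §1 p. 644
(p0006 L41–42) "Clearly `S(A)` depends only on the isogeny class of `A`."; p. 657 (p0019 L12–22) "If `A`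
is not a supersingular elliptic curve, then `K` is a CM-field, and `S(A)` is a torus. […] We can now
apply Lemma 3.8 to deduce that `H*(A^r)^{S(A)}` is generated as a `k`-algebra by `H²(A^r)^{S(A)}`.";
Cor. 4.5 (p. 659) "For any abelian variety `A` and any `r ≥ 0`, `H^{2*}(A^r)(*)^{L(A)} = D_hom(A^r)_k`."
J. S. Milne, *Lefschetz motives and the Tate conjecture*, Compositio Math. 117 (1999), §2 p. 54
[`paper:doi-10-1023-a-1000776613765` p0010 L15–17]: "A simple Abelian variety `A` over `C` is said to be
of CM-type if `End⁰(A)` is a field (necessarily CM) of degree `2 dim A` over `Q`".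

## What is proved

* `exteriorPullback_isogenyConj` — **transport of `⋀•` along an isogeny** `f : A ⟶ B`:
  `⋀ᵏ(f^* ∘ u ∘ (f^*)⁻¹) = f^* ∘ ⋀ᵏu ∘ ⋀ᵏ((f^*)⁻¹)` on `Hᵏ(A(ℂ); ℂ)` (`⋀ᵏ(f^*|_{H¹}) = f^*|_{Hᵏ}`,
  `exteriorPullback_isogenyPullbackOne`), and `f^* (⋀ᵏ((f^*)⁻¹) x) = x`
  (`map_exteriorPullback_isogenyPullbackOne_symm`).
* **`specialLefschetzGroup_invariants_le_of_isIsogeny_isCMTypeRealisation`** — for an isogeny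
  `f : A ⟶ B` onto a realisation `(B, ι, θ)` of a CM type with `θ(K) ⊆ C(B)`: the `S(A)`-invariants of
  `H^{2p}(A(ℂ); ℂ)` lie in `Dᵖ(A) ⊗ ℂ` (pull the polarization class back, `S(B)(ℂ) ≅ S(A)(ℂ)` by
  `u ↦ f^* ∘ u ∘ (f^*)⁻¹`, `isogenyConj_mem_unitaryCentralizerGroup_iff`; run the torus argument on `B`
  for `y = ⋀((f^*)⁻¹) x`; come back with `f^*(Dᵖ(B) ⊗ ℂ) = Dᵖ(A) ⊗ ℂ`,
  `HodgeTheory.divisorClassesSpan_map_eq_of_isIsogeny`).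
* **`specialLefschetzGroup_invariants_le_of_isSimple_of_isOfCMType`** — THE RESULT: for every simple
  complex abelian variety `A` of CM type with `0 < dim A`, every `x ∈ H^{2p}(A(ℂ); ℂ)` fixed by
  `specialLefschetzGroup (dim A) A.X` lies in `divisorClassesSpan A.X (dim A) p`;
  `setOf_forall_apply_eq_self_eq_divisorClassesSpan_of_isSimple_of_isOfCMType` (Cor. 4.5 as an equality
  of sets) and `isDivisorGenerated_of_hodgeGroup_eq_specialLefschetzGroup_of_isSimple_of_isOfCMType`
  (Prop. 4.8 (c) ⇒ (a), record-free for simple CM `A`).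

NOT here: non-simple `A` (Milne's reduction Prop. 1.5 / Cor. 4.7 to the simple factors, and the factors
of types I–III: invariant theory, Prop. 3.6) — the record `Milne1999_specialLefschetzGroup_invariants_le`
itself stays cited.

## References

* [Milne1999LefschetzClasses] J. S. Milne, Lefschetz classes on abelian varieties, Duke Math. J. 96
  (1999) 639–675: §1 p. 644, Thm. 3.2, Lemma 3.8 and p. 657, Thm. 4.4, Cor. 4.5, Prop. 4.8.
* [Milne1999] J. S. Milne, Lefschetz motives and the Tate conjecture, Compositio Math. 117 (1999)
  47–81: §2 p. 54.
* [Deligne1982HodgeCycles] P. Deligne, Hodge cycles on abelian varieties, LNM 900 (1982): I Prop. 5.1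
  and §5 p. 37.
* [vanGeemen1994HodgeAV] B. van Geemen, An introduction to the Hodge conjecture for abelian varieties,
  LNM 1594 (1994): §2.4, §3.6.
* [MumfordAV1970] D. Mumford, Abelian Varieties (1970): §19 (Remark p. 169, Cor. 2 p. 174).
-/

noncomputable section

open CategoryTheory NumberField
open Literature.AlgebraicTopology.SingularHomology
open Literature.AlgebraicGeometry.HodgeTheory
open Literature.AlgebraicGeometry.Motives
open Literature.AlgebraicGeometry.ComplexMultiplication (IsCMTypeRealisation
  endAlgebra_comm_and_finrank_eq_of_isSimple_of_isOfCMType)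
open Literature.AlgebraicGeometry.VanGeemen1994 (hodgeClassSpan)
open Literature.Barriers.HodgeConjecture (divisorClassesSpan)
open Literature.Geometry.Kaehler (lefschetzPow lefschetzPow_map)

namespace Literature.AlgebraicGeometry.Milne1999

/-! ### §1 Transport of the exterior action along an isogeny -/

section Transport

variable {A B : AbelianVariety ℂ} {f : A ⟶ B}

/-- **`⋀ᵏ(f^*|_{H¹}) = f^*|_{Hᵏ}`** for an isogeny `f : A ⟶ B` (`f^*` is multiplicative, Hatcher Prop.
3.10; the tree's `exteriorPullback_map_apply`). [cite: HatcherAT2002, §3.2 Prop. 3.10]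
[cite: vanGeemen1994HodgeAV, §3.6 (p. 236)] -/
theorem exteriorPullback_isogenyPullbackOne (hf : AbelianVariety.IsIsogeny f) (k : ℕ) (y : complexBetti B.X k) :
    exteriorPullback (AbelianVariety.hasExteriorCohomologyH1_complexPoints B)
      (isogenyPullbackOne hf : complexBetti B.X 1 →ₗ[ℂ] complexBetti A.X 1) k y =
        complexBetti.map f.hom.hom.hom k y := by
  rw [exteriorPullback_congr (AbelianVariety.hasExteriorCohomologyH1_complexPoints B)
    (L := (isogenyPullbackOne hf : complexBetti B.X 1 →ₗ[ℂ] complexBetti A.X 1))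
    (L' := (complexBetti.map f.hom.hom.hom 1).hom) (fun v => rfl) k]
  exact exteriorPullback_map_apply (AbelianVariety.hasExteriorCohomologyH1_complexPoints B) _ k y

/-- **`f^* (⋀ᵏ((f^*)⁻¹) x) = x`**: `⋀ᵏ(f^*) ∘ ⋀ᵏ((f^*)⁻¹) = ⋀ᵏ(id) = id`. [cite: HatcherAT2002, §3.2 Example 3.16]
[cite: vanGeemen1994HodgeAV, §3.6 (p. 236)] -/
theorem map_exteriorPullback_isogenyPullbackOne_symm (hf : AbelianVariety.IsIsogeny f) (k : ℕ)
    (x : complexBetti A.X k) :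
    complexBetti.map f.hom.hom.hom k
      (exteriorPullback (AbelianVariety.hasExteriorCohomologyH1_complexPoints A)
        ((isogenyPullbackOne hf).symm : complexBetti A.X 1 →ₗ[ℂ] complexBetti B.X 1) k x) = x := by
  rw [← exteriorPullback_isogenyPullbackOne hf k, ← LinearMap.comp_apply,
    ← exteriorPullback_comp (AbelianVariety.hasExteriorCohomologyH1_complexPoints A)
      (AbelianVariety.hasExteriorCohomologyH1_complexPoints B),
    ← LinearEquiv.coe_trans, LinearEquiv.symm_trans_self, LinearEquiv.refl_toLinearMap,
    exteriorPullback_id, LinearMap.id_apply]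

/-- **Transport of `⋀•` along an isogeny**: for `u ∈ GL(H¹(B(ℂ); ℂ))` and Milne's transported
automorphism `f^* ∘ u ∘ (f^*)⁻¹` of `H¹(A(ℂ); ℂ)` (`isogenyConj`),
`⋀ᵏ(f^* ∘ u ∘ (f^*)⁻¹) x = f^* (⋀ᵏu (⋀ᵏ((f^*)⁻¹) x))`. [cite: Milne1999LefschetzClasses, §1 p. 643–644]
[cite: HatcherAT2002, §3.2 Prop. 3.10] -/
theorem exteriorPullback_isogenyConj (hf : AbelianVariety.IsIsogeny f)
    (u : complexBetti B.X 1 ≃ₗ[ℂ] complexBetti B.X 1) (k : ℕ) (x : complexBetti A.X k) :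
    exteriorPullback (AbelianVariety.hasExteriorCohomologyH1_complexPoints A)
      (isogenyConj hf u : complexBetti A.X 1 →ₗ[ℂ] complexBetti A.X 1) k x =
      complexBetti.map f.hom.hom.hom k
        (exteriorPullback (AbelianVariety.hasExteriorCohomologyH1_complexPoints B)
          (u : complexBetti B.X 1 →ₗ[ℂ] complexBetti B.X 1) k
          (exteriorPullback (AbelianVariety.hasExteriorCohomologyH1_complexPoints A)
            ((isogenyPullbackOne hf).symm : complexBetti A.X 1 →ₗ[ℂ] complexBetti B.X 1) k x)) := by
  have hcomp : (isogenyConj hf u : complexBetti A.X 1 →ₗ[ℂ] complexBetti A.X 1) =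
      (isogenyPullbackOne hf : complexBetti B.X 1 →ₗ[ℂ] complexBetti A.X 1).comp
        ((u : complexBetti B.X 1 →ₗ[ℂ] complexBetti B.X 1).comp
          ((isogenyPullbackOne hf).symm : complexBetti A.X 1 →ₗ[ℂ] complexBetti B.X 1)) :=
    LinearMap.ext fun _ => rfl
  rw [hcomp, exteriorPullback_comp (AbelianVariety.hasExteriorCohomologyH1_complexPoints A)
      (AbelianVariety.hasExteriorCohomologyH1_complexPoints B),
    exteriorPullback_comp (AbelianVariety.hasExteriorCohomologyH1_complexPoints A)
      (AbelianVariety.hasExteriorCohomologyH1_complexPoints B),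
    LinearMap.comp_apply, LinearMap.comp_apply, exteriorPullback_isogenyPullbackOne]

/-- **The hypothesis transported**: if `⋀ᵏ(f^* ∘ u ∘ (f^*)⁻¹)` fixes `x ∈ Hᵏ(A(ℂ); ℂ)` then `⋀ᵏu` fixes
`y = ⋀ᵏ((f^*)⁻¹) x ∈ Hᵏ(B(ℂ); ℂ)` (`f^*` is injective on `Hᵏ`, `complexBetti_map_bijective_of_isIsogeny`).
[cite: Milne1999LefschetzClasses, §1 p. 644] [cite: vanGeemen1994HodgeAV, §3.6 (p. 236)] -/
theorem exteriorPullback_apply_eq_self_of_isogenyConj (hf : AbelianVariety.IsIsogeny f)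
    (u : complexBetti B.X 1 ≃ₗ[ℂ] complexBetti B.X 1) (k : ℕ) {x : complexBetti A.X k}
    (hx : exteriorPullback (AbelianVariety.hasExteriorCohomologyH1_complexPoints A)
      (isogenyConj hf u : complexBetti A.X 1 →ₗ[ℂ] complexBetti A.X 1) k x = x) :
    exteriorPullback (AbelianVariety.hasExteriorCohomologyH1_complexPoints B)
        (u : complexBetti B.X 1 →ₗ[ℂ] complexBetti B.X 1) k
        (exteriorPullback (AbelianVariety.hasExteriorCohomologyH1_complexPoints A)
          ((isogenyPullbackOne hf).symm : complexBetti A.X 1 →ₗ[ℂ] complexBetti B.X 1) k x) =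
      exteriorPullback (AbelianVariety.hasExteriorCohomologyH1_complexPoints A)
        ((isogenyPullbackOne hf).symm : complexBetti A.X 1 →ₗ[ℂ] complexBetti B.X 1) k x := by
  apply (complexBetti_map_bijective_of_isIsogeny hf k).1
  rw [← exteriorPullback_isogenyConj, hx, map_exteriorPullback_isogenyPullbackOne_symm]

/-- **The pulled-back polarization class**: for an isogeny `f : A ⟶ B` and `h ∈ B¹(B) ⊗ ℂ` with
`h^{dim B} ≠ 0` and `Q_h` non-degenerate on `H¹(B)`, the class `f^*h` has the same three properties on
`A` (`f^*` is an injective ring homomorphism in every degree and `dim A = dim B`). The three hypotheses of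
the tree's `exteriorPullbackEquiv_mem_specialLefschetzGroup`, transported.
[cite: Milne1999LefschetzClasses, §1 p. 644 and Thm. 4.4 (proof, p. 659)] [cite: HatcherAT2002, §3.2 Prop. 3.10] -/
theorem polarization_hypotheses_map (hf : AbelianVariety.IsIsogeny f) {h : complexBetti B.X 2}
    (hh : h ∈ hodgeClassSpan B.dim B.X 1) (htop : lefschetzPow h (B.dim - 1) 2 h ≠ 0)
    (hnd : ∀ x : complexBetti B.X 1, (∀ y, polarizationPairingOne B.X h (B.dim - 1) x y = 0) → x = 0) :
    complexBetti.map f.hom.hom.hom 2 h ∈ hodgeClassSpan A.dim A.X 1 ∧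
      lefschetzPow (complexBetti.map f.hom.hom.hom 2 h) (A.dim - 1) 2 (complexBetti.map f.hom.hom.hom 2 h) ≠ 0 ∧
      ∀ x : complexBetti A.X 1, (∀ y, polarizationPairingOne A.X (complexBetti.map f.hom.hom.hom 2 h)
        (A.dim - 1) x y = 0) → x = 0 := by
  have hdim : A.dim = B.dim := AbelianVariety.dim_eq_of_isIsogeny hf
  refine ⟨map_mem_hodgeClassSpan_one f hh, ?_, ?_⟩
  · rw [hdim]
    intro h0
    apply htop
    apply (complexBetti_map_bijective_of_isIsogeny hf (2 + 2 * (B.dim - 1))).1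
    rw [map_zero]
    exact (lefschetzPow_map _ h (B.dim - 1) 2 h).trans h0
  · rw [hdim]
    intro x hx
    obtain ⟨x', rfl⟩ := (isogenyPullbackOne hf).surjective x
    rw [isogenyPullbackOne_apply]
    have hx' : x' = 0 := hnd x' fun y' => by
      apply (complexBetti_map_bijective_of_isIsogeny hf (2 + 2 * (B.dim - 1))).1
      rw [map_zero, map_polarizationPairingOne]
      exact hx _
    rw [hx', map_zero]

end Transport

/-! ### §2 The invariants of `S(A)` along an isogeny onto a CM realisation -/

section Main

variable {K : Type} [Field K] [NumberField K] [IsCMField K] {Φ : CMType K} {A B : AbelianVariety ℂ}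
  {ι : 𝓞 K →+* End B} {θ : K →+* Module.End ℂ (complexBetti B.X 1)} {f : A ⟶ B}

/-- **Theorem 3.2 / Cor. 4.5 transported along an isogeny `f : A ⟶ B` onto a realisation `(B, ι, θ)` of
a CM type with `θ(K) ⊆ C(B)`**: every class `x ∈ H^{2p}(A(ℂ); ℂ)` fixed by `specialLefschetzGroup (dim A) A.X`
lies in `Dᵖ(A) ⊗ ℂ`. For `u ∈ S(B)(ℂ)` (Rosati-compatible polarization class `h` on `B`),
`f^* ∘ u ∘ (f^*)⁻¹ ∈ S(A)(ℂ)` for `f^*h` ("`S(A)` depends only on the isogeny class",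
`isogenyConj_mem_unitaryCentralizerGroup_iff`), its Künneth family lies in `specialLefschetzGroup`
(`exteriorPullbackEquiv_mem_specialLefschetzGroup`, Thm. 4.4), so `⋀u` fixes `y = ⋀((f^*)⁻¹) x`; the torus
argument on `B` (`mem_divisorClassesSpan_of_forall_exteriorPullback_eq`) puts `y` in `Dᵖ(B) ⊗ ℂ`, and
`x = f^* y ∈ f^*(Dᵖ(B) ⊗ ℂ) = Dᵖ(A) ⊗ ℂ`. [cite: Milne1999LefschetzClasses, §1 p. 644, Thm. 3.2 and p. 657, Cor. 4.5]
[cite: vanGeemen1994HodgeAV, §2.4 and §3.6] -/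
theorem specialLefschetzGroup_invariants_le_of_isIsogeny_isCMTypeRealisation (hf : AbelianVariety.IsIsogeny f)
    (hB : IsCMTypeRealisation Φ B ι θ) (hθ : ∀ a : K, θ a ∈ centralizerAlgebra B) (p : ℕ)
    (x : complexBetti A.X (2 * p)) (hx : ∀ g ∈ specialLefschetzGroup A.dim A.X, g (2 * p) x = x) :
    x ∈ divisorClassesSpan A.X A.dim p := by
  obtain ⟨h, hQ, -, ⟨s, hs, hK⟩, hros⟩ := hB.exists_rosati_kaehlerClass
  have hB0 : 0 < B.dim := by
    have h1 := AbelianVariety.finrank_complexBetti_one B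
    rw [hB.2.1] at h1
    have h2 : 0 < Module.finrank ℚ K := Module.finrank_pos
    omega
  have hdim : A.dim = B.dim := AbelianVariety.dim_eq_of_isIsogeny hf
  have hA0 : 0 < A.dim := hdim ▸ hB0
  obtain ⟨hh, htop, hnd⟩ := polarization_hypotheses_map hf
    (mem_hodgeClassSpan_one_of_isKaehlerClass_smul hQ hs hK)
    (lefschetzPow_self_ne_zero_of_isKaehlerClass_smul hB0 hK)
    (eq_zero_of_forall_polarizationPairingOne_eq_zero_of_isKaehlerClass_smul' hs hK)
  -- `y = ⋀((f^*)⁻¹) x` is fixed by `⋀u` for every `u ∈ S(B)(ℂ)`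
  set y : complexBetti B.X (2 * p) :=
    exteriorPullback (AbelianVariety.hasExteriorCohomologyH1_complexPoints A)
      ((isogenyPullbackOne hf).symm : complexBetti A.X 1 →ₗ[ℂ] complexBetti B.X 1) (2 * p) x with hy_def
  have hy : ∀ u ∈ unitaryCentralizerGroup B h,
      exteriorPullback (AbelianVariety.hasExteriorCohomologyH1_complexPoints B)
        (u : complexBetti B.X 1 →ₗ[ℂ] complexBetti B.X 1) (2 * p) y = y := by
    intro u hu
    have hv : isogenyConj hf u ∈ unitaryCentralizerGroup A (complexBetti.map f.hom.hom.hom 2 h) :=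
      (isogenyConj_mem_unitaryCentralizerGroup_iff hf h).2 hu
    exact exteriorPullback_apply_eq_self_of_isogenyConj hf u (2 * p)
      (hx _ (exteriorPullbackEquiv_mem_specialLefschetzGroup hA0 hh htop hnd hv))
  have hyD : y ∈ divisorClassesSpan B.X B.dim p :=
    mem_divisorClassesSpan_of_forall_exteriorPullback_eq hB hθ hros p y hy
  -- `x = f^* y ∈ f^*(Dᵖ(B) ⊗ ℂ) = Dᵖ(A) ⊗ ℂ`
  rw [← map_exteriorPullback_isogenyPullbackOne_symm hf (2 * p) x, ← divisorClassesSpan_map_eq_of_isIsogeny hf p]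
  exact Submodule.mem_map_of_mem hyD

end Main

/-! ### §3 Every simple complex abelian variety of CM type -/

section Simple

variable {A : AbelianVariety ℂ}

/-- **The endomorphisms of a simple complex abelian variety of CM type commute** (`End⁰(A)` "is a field
(necessarily CM) of degree `2 dim A`", Milne 1999b §2 p. 54 — the tree's
`endAlgebra_comm_and_finrank_eq_of_isSimple_of_isOfCMType`, and `End(A) ↪ End⁰(A)`,
`endAlgebra.of_injective_of_charZero`). [cite: Milne1999, §2 p. 54] [cite: MumfordAV1970, §19 Cor. 2 of Thm. 1 (p. 174)] -/
theorem comp_comm_of_isSimple_of_isOfCMType (hA : AbelianVariety.IsSimple A) (hCM : IsOfCMType A)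
    (φ ψ : A ⟶ A) : φ ≫ ψ = ψ ≫ φ := by
  haveI : _root_.AlgebraicGeometry.IsClosedImmersion (AbelianVariety.Hom.toSchemeHom (𝟙 A)) := by
    change _root_.AlgebraicGeometry.IsClosedImmersion (𝟙 A.X.left)
    infer_instance
  obtain ⟨hcomm, -⟩ := endAlgebra_comm_and_finrank_eq_of_isSimple_of_isOfCMType hCM hA (𝟙 A)
  apply AbelianVariety.endAlgebra.of_injective_of_charZero (A := A)
  change AbelianVariety.endAlgebra.of A (End.of ψ * End.of φ) =
    AbelianVariety.endAlgebra.of A (End.of φ * End.of ψ)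
  rw [map_mul, map_mul, hcomm]

/-- **Milne 1999, Cor. 4.5 (with Thm. 4.4 and Thm. 3.2) — the conclusion of the record
`Milne1999_specialLefschetzGroup_invariants_le` — for every SIMPLE complex abelian variety of CM type**
(`AbelianVariety.IsSimple A`, `0 < dim A`, `Milne1999.IsOfCMType A`): every class `x ∈ H^{2p}(A(ℂ); ℂ)`
fixed by every element of `specialLefschetzGroup (dim A) A.X` lies in
`Dᵖ_hom(A)_ℂ = divisorClassesSpan A.X (dim A) p`. Proof: `A` is isogenous to a CM-typed `A′`
(`exists_isCMTyped_isIsogenous_of_isSimple`); `A′` is simple of CM type, so `End(A′)` is commutative and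
`θ′(K) ⊆ C(A′)`; apply `specialLefschetzGroup_invariants_le_of_isIsogeny_isCMTypeRealisation` (Milne's
torus case, p. 657, transported along the isogeny).
[cite: Milne1999LefschetzClasses, Cor. 4.5, Thm. 3.2 and p. 657, §1 p. 644] [cite: Milne1999, §2 p. 54]
[cite: Deligne1982HodgeCycles, I Prop. 5.1 and §5 (p. 37)] -/
theorem specialLefschetzGroup_invariants_le_of_isSimple_of_isOfCMType (hA : AbelianVariety.IsSimple A)
    (hA0 : 0 < A.dim) (hCM : IsOfCMType A) (p : ℕ) (x : complexBetti A.X (2 * p))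
    (hx : ∀ g ∈ specialLefschetzGroup A.dim A.X, g (2 * p) x = x) :
    x ∈ divisorClassesSpan A.X A.dim p := by
  obtain ⟨B, hBT, f, hf⟩ := exists_isCMTyped_isIsogenous_of_isSimple A hA hA0 hCM
  obtain ⟨Φ, B, ι, θ, hB⟩ := hBT
  have hBs : AbelianVariety.IsSimple B := hA.of_isIsogeny hf
  have hBCM : IsOfCMType B := hCM.of_isIsogeny hf
  exact specialLefschetzGroup_invariants_le_of_isIsogeny_isCMTypeRealisation hf hB
    (hB.theta_mem_centralizerAlgebra_of_comm (comp_comm_of_isSimple_of_isOfCMType hBs hBCM)) p x hx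

/-- **Cor. 4.5 as an equality of sets, for every simple complex abelian variety of CM type**: the
`S(A)`-invariants of `H^{2p}(A(ℂ); ℂ)` are EXACTLY `Dᵖ_hom(A)_ℂ`.
[cite: Milne1999LefschetzClasses, Cor. 4.5 (p. 659)] -/
theorem setOf_forall_apply_eq_self_eq_divisorClassesSpan_of_isSimple_of_isOfCMType
    (hA : AbelianVariety.IsSimple A) (hA0 : 0 < A.dim) (hCM : IsOfCMType A) (p : ℕ) :
    {x : complexBetti A.X (2 * p) | ∀ g ∈ specialLefschetzGroup A.dim A.X, g (2 * p) x = x} =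
      (divisorClassesSpan A.X A.dim p : Set _) :=
  Set.Subset.antisymm
    (fun x hx => specialLefschetzGroup_invariants_le_of_isSimple_of_isOfCMType hA hA0 hCM p x hx)
    fun _ hx _ hg => apply_eq_self_of_mem_specialLefschetzGroup hg hx

/-- **Milne Prop. 4.8, (c) ⇒ (a) on `A` itself, record-free for every simple complex abelian variety of CM
type**: if `Hg′(A) = S(A)` then `A` supports no exotic Hodge class (`IsDivisorGenerated A`).
[cite: Milne1999LefschetzClasses, Prop. 4.8 and Cor. 4.5 (pp. 659–660)] -/
theorem isDivisorGenerated_of_hodgeGroup_eq_specialLefschetzGroup_of_isSimple_of_isOfCMType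
    (hA : AbelianVariety.IsSimple A) (hA0 : 0 < A.dim) (hCM : IsOfCMType A)
    (hHg : hodgeGroup A.dim A.X = specialLefschetzGroup A.dim A.X) : IsDivisorGenerated A :=
  fun p c hc hpp => specialLefschetzGroup_invariants_le_of_isSimple_of_isOfCMType hA hA0 hCM p c
    fun _ hg => apply_eq_self_of_mem_hodgeGroup (hHg ▸ hg) hc hpp

end Simple

end Literature.AlgebraicGeometry.Milne1999

end
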